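import Summits.ValiantsHypothesis.ValiantsHypothesis.Theorems.TwoProducts.RankThreeAffineFewnomial

/-!
# Rank three AFFINE, OLM slices: `P(x, y, u)` with `u`-degree `≤ k` is tame for every FIXED `k` — bookkeeping off the unit ladder

★ BOOKKEEPING corollary of ✓ `card_Eset_unitSum_le` (`…RankThreeAffineUnitLadder`, val-port-1 g5) for the OLM slot of the OPEN rung 3-AFF of the SIDE ladder
«table-rank-ladder» of crux `stmt-ValiantsHypothesis-5906` (`TwoProducts`), priced by val-idea-crit-8 g5 VERDICT #83 (2) (one writer = D1's author; val-port-4 g5's OLM hand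
is k-UNIFORMITY and cites this file).  THE OBSERVATION: in the OLM slot `N = P(x, y, u) = Σ_{j ≤ k} g_j(x,y)·u^j` the powers `u^j` are UNITS WITH ZERO NUMERATOR for the
derivation `J(·,u)` — `1·J(u^j, u) = u^j·0` (✓ `jac_C_mul_pow_self`), `|Eset σ (u^j)| ≤ t²` (✓ `Eset_pow_subset`), `M = 1` — and the dense slices `g_j` (total degree `≤ m`,
`≤ (m+1)³` terms) ARE the sparse coefficients; so the ladder gives, per chart, `|Eset σ N| ≤ ladderBound t 1 0 t² (k+1) (m+1)³` and
★ `olmSlice_nv_le : nv (MvPolynomial.aeval ![X 0, X 1, u] P) ≤ olmSliceBound k m t` — `poly(m,t)` for every FIXED `u`-degree `k`, exponent `2^k`-readable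
(`olmSlice_law`: `≤ (m+2)^c (t+2)^c`, `c = 3·ladderExp (k+1) + 1`); constant `u` inside (`N` has `≤ (m+1)³` monomials).  EXPLICIT form only: `OLMLaw` itself
(`k = m`, poly(m,t) — val-idea-35 g11's Cruxes typing) is NOT restated and NOT proved: the ladder pays `(mt)^{O(2^k)}`.
RESIDUE OF RECORD it sharpens (crit-8 #83): «OLM slot: u-degree k growing with m (k-uniformity); the ladder pays (mt)^{O(2^k)}, a Wronskian would pay (mt)^{O(k²)}, the law
wants poly(m,t) at k = m».  HONEST LABEL: ★ bookkeeping; side-ladder; NOT γ; `RankThreeAffineLaw(Exp)` / `OLMLaw` / `LevelOneLaw` / `TwoProducts` / `PlanarCellBound` /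
`ResidualLawV25` UNMOVED; 0 summit distance; VP ≠ VNP is NOT proved here or anywhere in this tree.  `--supports stmt-ValiantsHypothesis-5906 --as helper`.
Vocabulary BY IMPORT (✓ `…RankThreeAffineFewnomial` → `…UnitLadder` → …): `ladderBound`, `ladderExp`, `ladderBound_le_pow`, `card_Eset_unitSum_le`, `nv_le`,
`nv_le_card_support`, `Eset_pow_subset`, `card_Eset_le_sq`, `eq_C_of_S1_empty`, `jac_C_mul_pow_self`.  No instances, no notation, no named facts. [folklore]
-/

noncomputable section
set_option linter.dupNamespace false

namespace Summit.ValiantsHypothesis.ValiantsHypothesis.Theorems.TwoProducts.RankTwoJacobian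

open scoped BigOperators Pointwise Classical
open MvPolynomial

/-! ### §1 Exponents of a polynomial of total degree `≤ m`; the `u`-slices -/

/-- Each exponent coordinate is bounded by the total degree. [folklore] -/
theorem expo_le_totalDegree {P : Poly3} {s : Fin 3 →₀ ℕ} (hs : s ∈ P.support) (i : Fin 3) : s i ≤ P.totalDegree := by
  have h1 : s i ≤ s.sum (fun _ e => e) := by
    by_cases h : i ∈ s.support
    · exact Finset.single_le_sum (fun j _ => Nat.zero_le (s j)) h
    · rw [Finsupp.notMem_support_iff.mp h]; exact Nat.zero_le _
  exact h1.trans (le_totalDegree hs)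

/-- `|supp P| ≤ (m+1)³` for `P ∈ ℂ[X₀,X₁,X₂]` of total degree `≤ m`. [folklore] -/
theorem card_support_le_cube {P : Poly3} {m : ℕ} (hP : P.totalDegree ≤ m) : P.support.card ≤ (m + 1) ^ 3 := by
  have hmaps : ∀ s ∈ P.support, (fun i => s i) ∈ Fintype.piFinset (fun _ : Fin 3 => Finset.range (m + 1)) := by
    intro s hs
    rw [Fintype.mem_piFinset]
    intro i
    exact Finset.mem_range.mpr (Nat.lt_succ_of_le ((expo_le_totalDegree hs i).trans hP))
  have hinj : Set.InjOn (fun (s : Fin 3 →₀ ℕ) (i : Fin 3) => s i) P.support := by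
    intro s _ s' _ h
    exact Finsupp.ext fun i => congrFun h i
  calc P.support.card ≤ (Fintype.piFinset (fun _ : Fin 3 => Finset.range (m + 1))).card :=
        Finset.card_le_card_of_injOn _ hmaps hinj
    _ = (m + 1) ^ 3 := by rw [Fintype.card_piFinset_const, Finset.card_range]

/-- the `j`-th `u`-SLICE of `P`: `g_j(x,y) = Σ_{s ∈ supp P, s₂ = j} coeff_s · x^{s₀} y^{s₁}` -/
def uSlice (P : Poly3) (j : ℕ) : Poly2 :=
  ∑ s ∈ P.support.filter (fun s => s 2 = j), monomial (Finsupp.single 0 (s 0) + Finsupp.single 1 (s 1)) (coeff s P)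

/-- A slice has at most `|supp P| ≤ (m+1)³` monomials. [folklore] -/
theorem card_support_uSlice_le {P : Poly3} {m : ℕ} (hP : P.totalDegree ≤ m) (j : ℕ) : (uSlice P j).support.card ≤ (m + 1) ^ 3 := by
  unfold uSlice
  refine (Finset.card_le_card (MvPolynomial.support_sum)).trans ((Finset.card_biUnion_le).trans ?_)
  refine le_trans (Finset.sum_le_sum fun s _ => Finset.card_le_card support_monomial_subset) ?_
  simp only [Finset.card_singleton, Finset.sum_const, smul_eq_mul, mul_one]
  exact (Finset.card_filter_le _ _).trans (card_support_le_cube hP)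

/-- `monomial (a·e₀ + b·e₁) c = c · x^a · y^b` in `ℂ[x,y]`. [folklore] -/
theorem monomial_two_singles (a b : ℕ) (c : ℂ) : (monomial (Finsupp.single 0 a + Finsupp.single 1 b) c : Poly2) = C c * X 0 ^ a * X 1 ^ b := by
  have h : (monomial (Finsupp.single 1 b) c : Poly2) = C c * X 1 ^ b := by
    rw [X_pow_eq_monomial, C_mul_monomial, mul_one]
  rw [monomial_single_add, h]
  ring

/-- A monomial of `ℂ[X₀,X₁,X₂]` under the OLM substitution `X₂ ↦ u`. [folklore] -/
theorem aeval_olm_monomial (u : Poly2) (s : Fin 3 →₀ ℕ) (c : ℂ) :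
    MvPolynomial.aeval ![X 0, X 1, u] (monomial s c) = u ^ s 2 * monomial (Finsupp.single 0 (s 0) + Finsupp.single 1 (s 1)) c := by
  rw [MvPolynomial.aeval_monomial, MvPolynomial.algebraMap_eq, Finsupp.prod_fintype _ _ (fun i => pow_zero _), Fin.prod_univ_three]
  simp only [Matrix.cons_val_zero, Matrix.cons_val_one, Matrix.cons_val_two, Matrix.head_cons, Matrix.tail_cons]
  rw [monomial_two_singles]
  ring

/-- **`P(x, y, u) = Σ_j u^j · g_j(x,y)`** over the `u`-degrees `j` occurring in `P`. [folklore] -/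
theorem aeval_olm_eq_sum (P : Poly3) (u : Poly2) :
    MvPolynomial.aeval ![X 0, X 1, u] P = ∑ j ∈ P.support.image (fun s => s 2), u ^ j * uSlice P j := by
  conv_lhs => rw [P.as_sum, map_sum]
  rw [← Finset.sum_fiberwise_of_maps_to (g := fun s : Fin 3 →₀ ℕ => s 2) (fun s hs => Finset.mem_image_of_mem _ hs)]
  refine Finset.sum_congr rfl fun j _ => ?_
  unfold uSlice
  rw [Finset.mul_sum]
  refine Finset.sum_congr rfl fun s hs => ?_
  obtain ⟨-, hj⟩ := Finset.mem_filter.mp hs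
  rw [aeval_olm_monomial, hj]

/-! ### §2 Per chart: the unit ladder with the units `u^j` (zero numerators) -/

/-- ★ **Per chart, `u` non-constant:** `|Eset σ (P(x,y,u))| ≤ ladderBound t 1 0 t² (k+1) (m+1)³` when `P` has `u`-degree `≤ k` and total degree `≤ m`. -/
theorem card_Eset_olmSlice_le {σ : ℝ} (hσ : σ = 1 ∨ σ = -1) {k m t : ℕ} (P : Poly3) (u : Poly2)
    (hk : ∀ s ∈ P.support, s 2 ≤ k) (hP : P.totalDegree ≤ m) (hu : u.support.card ≤ t) (hS : (S1 u).Nonempty) :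
    (Eset σ (MvPolynomial.aeval ![X 0, X 1, u] P)).card ≤ ladderBound t 1 0 (t * t) (k + 1) ((m + 1) ^ 3) := by
  rw [aeval_olm_eq_sum]
  have hu0 : u ≠ 0 := by
    rintro rfl
    obtain ⟨s, hs⟩ := hS
    simp [mem_S1] at hs
  have hK : (P.support.image (fun s => s 2)).card ≤ k + 1 := by
    have hsub : P.support.image (fun s => s 2) ⊆ Finset.range (k + 1) := by
      intro j hj
      obtain ⟨s, hs, rfl⟩ := Finset.mem_image.mp hj
      exact Finset.mem_range.mpr (Nat.lt_succ_of_le (hk s hs))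
    exact (Finset.card_le_card hsub).trans (by simp)
  refine card_Eset_unitSum_le hσ hS hu one_ne_zero (by rw [MvPolynomial.support_one, Finset.card_singleton])
    (fun j : ℕ => u ^ j) (fun _ => (0 : Poly2)) (fun j => pow_ne_zero j hu0) (fun j => ?_) (fun _ => by simp)
    (fun j => (Finset.card_le_card (Eset_pow_subset hσ u j)).trans (card_Eset_le_sq σ u hu))
    (k + 1) _ (fun j => uSlice P j) ((m + 1) ^ 3) hK (fun j _ => card_support_uSlice_le hP j)
  rw [one_mul, mul_zero]
  have h := jac_C_mul_pow_self 1 u j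
  rwa [C_1, one_mul] at h

/-- Constant `u`: `P(x, y, u)` has at most `|supp P| ≤ (m+1)³` monomials. [folklore] -/
theorem card_support_aeval_olm_const_le (P : Poly3) (u : Poly2) (hS : ¬ (S1 u).Nonempty) {m : ℕ} (hP : P.totalDegree ≤ m) :
    (MvPolynomial.aeval ![X 0, X 1, u] P).support.card ≤ (m + 1) ^ 3 := by
  rw [aeval_olm_eq_sum]
  obtain ⟨c, hc⟩ : ∃ c : ℂ, u = C c := ⟨_, eq_C_of_S1_empty hS⟩
  subst hc
  refine (Finset.card_le_card (MvPolynomial.support_sum)).trans ((Finset.card_biUnion_le).trans ?_)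
  have hterm : ∀ j ∈ P.support.image (fun s => s 2),
      ((C c : Poly2) ^ j * uSlice P j).support.card ≤ (P.support.filter (fun s => s 2 = j)).card := by
    intro j _
    rw [← map_pow]
    refine (card_supp_C_mul_le _ _).trans ?_
    unfold uSlice
    refine (Finset.card_le_card (MvPolynomial.support_sum)).trans ((Finset.card_biUnion_le).trans ?_)
    refine le_trans (Finset.sum_le_sum (g := fun _ => 1) fun s _ => ?_) (by simp)
    exact (Finset.card_le_card support_monomial_subset).trans (by simp)
  refine (Finset.sum_le_sum hterm).trans ?_
  rw [← Finset.card_eq_sum_card_image (fun s : Fin 3 →₀ ℕ => s 2) P.support]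
  exact card_support_le_cube hP

/-! ### §3 The headline for every fixed `u`-degree `k`, and the law currency -/

/-- THE OLM-SLICE BOUND (explicit, computable): `2·ladderBound t 1 0 t² (k+1) (m+1)³ + (m+1)³ + 4`. -/
def olmSliceBound (k m t : ℕ) : ℕ := 2 * ladderBound t 1 0 (t * t) (k + 1) ((m + 1) ^ 3) + (m + 1) ^ 3 + 4

/-- ★ **OLM slices are tame for every FIXED `u`-degree:** for `P ∈ ℂ[X₀,X₁,X₂]` of total degree `≤ m` and `u`-degree `≤ k`, and `t`-sparse `u ∈ ℂ[x,y]`,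
`nv (P(x, y, u)) ≤ olmSliceBound k m t` (= `poly(m,t)` with exponent `~ 2^k`; no other hypothesis). -/
theorem olmSlice_nv_le (k m t : ℕ) (P : Poly3) (u : Poly2) (hk : ∀ s ∈ P.support, s 2 ≤ k) (hP : P.totalDegree ≤ m)
    (hu : u.support.card ≤ t) : nv (MvPolynomial.aeval ![X 0, X 1, u] P) ≤ olmSliceBound k m t := by
  unfold olmSliceBound
  by_cases hS : (S1 u).Nonempty
  · have h1 := card_Eset_olmSlice_le (σ := 1) (Or.inl rfl) P u hk hP hu hS
    have h2 := card_Eset_olmSlice_le (σ := -1) (Or.inr rfl) P u hk hP hu hS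
    have h := nv_le (MvPolynomial.aeval ![X 0, X 1, u] P)
    omega
  · -- `u` constant: `P(x,y,u)` has at most `|supp P| ≤ (m+1)³` monomials
    have h1 := card_support_aeval_olm_const_le P u hS hP
    have h2 : nv (MvPolynomial.aeval ![X 0, X 1, u] P) ≤ (MvPolynomial.aeval ![X 0, X 1, u] P).support.card :=
      nv_le_card_support _
    omega

/-- ★ **Law currency, every fixed `k`:** `nv (P(x,y,u)) ≤ (m+2)^c (t+2)^c` with `c = 3·ladderExp (k+1) + 1`. -/
theorem olmSlice_law : ∀ k : ℕ, ∃ c : ℕ, ∀ (m t : ℕ) (P : Poly3) (u : Poly2), (∀ s ∈ P.support, s 2 ≤ k) → P.totalDegree ≤ m →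
    u.support.card ≤ t → nv (MvPolynomial.aeval ![X 0, X 1, u] P) ≤ (m + 2) ^ c * (t + 2) ^ c := by
  intro k
  refine ⟨3 * ladderExp (k + 1) + 1, fun m t P u hk hP hu => (olmSlice_nv_le k m t P u hk hP hu).trans ?_⟩
  set Y := (m + 2) * (t + 2) with hY
  have hY4 : 4 ≤ Y := by rw [hY]; nlinarith
  -- the ladder base `t + 1 + 0 + t² + (m+1)³ + 2 ≤ Y³`
  have hbase : t + 1 + 0 + t * t + (m + 1) ^ 3 + 2 ≤ Y ^ 3 := by
    have a1 : t + 1 + t * t + 2 ≤ (t + 2) * (t + 2) := by nlinarith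
    have a2 : (m + 1) ^ 3 ≤ (m + 2) ^ 3 := Nat.pow_le_pow_left (by omega) 3
    have a3 : (t + 2) * (t + 2) + (m + 2) ^ 3 ≤ (m + 2) ^ 3 * ((t + 2) * (t + 2)) := by
      have h2 : 2 ≤ (t + 2) * (t + 2) := by nlinarith
      have h3 : 2 ≤ (m + 2) ^ 3 := le_trans (by norm_num : 2 ≤ 2 ^ 3) (Nat.pow_le_pow_left (by omega) 3)
      nlinarith
    have a4 : (m + 2) ^ 3 * ((t + 2) * (t + 2)) ≤ Y ^ 3 := by
      rw [hY, mul_pow]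
      have : (t + 2) * (t + 2) ≤ (t + 2) ^ 3 := by
        calc (t + 2) * (t + 2) = (t + 2) ^ 2 := by ring
          _ ≤ (t + 2) ^ 3 := Nat.pow_le_pow_right (by omega) (by norm_num)
      exact Nat.mul_le_mul_left _ this
    omega
  have hL := (ladderBound_le_pow t 1 0 (t * t) (k + 1) ((m + 1) ^ 3)).trans (Nat.pow_le_pow_left hbase (ladderExp (k + 1)))
  rw [← pow_mul] at hL
  have he : 1 ≤ ladderExp (k + 1) := one_le_ladderExp (k + 1)
  have hm3 : (m + 1) ^ 3 ≤ Y ^ (3 * ladderExp (k + 1)) := by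
    calc (m + 1) ^ 3 ≤ Y ^ 3 := by
          have : t + 1 + 0 + t * t + (m + 1) ^ 3 + 2 ≤ Y ^ 3 := hbase
          omega
      _ ≤ Y ^ (3 * ladderExp (k + 1)) := Nat.pow_le_pow_right (by omega) (by omega)
  have h4 : 4 ≤ Y ^ (3 * ladderExp (k + 1)) := le_trans hY4 (by
    calc Y = Y ^ 1 := (pow_one Y).symm
      _ ≤ Y ^ (3 * ladderExp (k + 1)) := Nat.pow_le_pow_right (by omega) (by omega))
  unfold olmSliceBound
  calc 2 * ladderBound t 1 0 (t * t) (k + 1) ((m + 1) ^ 3) + (m + 1) ^ 3 + 4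
      ≤ 2 * Y ^ (3 * ladderExp (k + 1)) + Y ^ (3 * ladderExp (k + 1)) + Y ^ (3 * ladderExp (k + 1)) := by omega
    _ = Y ^ (3 * ladderExp (k + 1)) * 4 := by ring
    _ ≤ Y ^ (3 * ladderExp (k + 1)) * Y := Nat.mul_le_mul_left _ hY4
    _ = Y ^ (3 * ladderExp (k + 1) + 1) := by rw [pow_succ]
    _ = (m + 2) ^ (3 * ladderExp (k + 1) + 1) * (t + 2) ^ (3 * ladderExp (k + 1) + 1) := by rw [hY, mul_pow]

end Summit.ValiantsHypothesis.ValiantsHypothesis.Theorems.TwoProducts.RankTwoJacobian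

end
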